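import Summits.ResolutionOfSingularities.ResolutionOfSingularities.Theorems.WeightedInvariantLocalWeightedDropTrackCEnd
import Summits.ResolutionOfSingularities.ResolutionOfSingularities.Theorems.WeightedInvariantLocalWeightedDropTrackCOffCentre
import Summits.ResolutionOfSingularities.ResolutionOfSingularities.Theorems.WeightedInvariantLocalWeightedDropTrackCBase

/-!
# Track C / Track T4: game-independent frame lemmas (transport off the centre, tautological frame, monomial frames at the end)

[OURS · L1 W4.3 · chain w43, Track T4; stub worker 4] Engine crux `LocalWeightedDrop` (stmt-ResolutionOfSingularities-8899).
NOT a statement of any manuscript.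

Track C (`…TrackCOffCentre`, `…TrackCBase`, `…TrackCEnd`) proved its three frame facts with the hypersurface game `Won` baked into
the conclusions.  Track T4 (the one-entry tuple game) needs the same facts for another game, so they are restated here ONCE in
game-independent form (proofs = those of Track C with the last line removed):

* `exists_frame_transport` — off the centre of a blow-up `τ`, a Cohen frame at `τ x'` transports to `x'` with the SAME reading
  of every total transform;
* `exists_tautological_frame` — the closed point of `Z₀ = Spec k⟦x₀,x₁,x₂⟧` carries a frame for `𝟙 Z₀` reading the total
  transform of every `f` as `f`;
* `exists_monomial_frame_of_prime_dvd_rsop`, `exists_monomial_frame_end` — at the end of a Cossart–Jannsen–Saito sequence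
  (`π⁻¹ V(f) = X₁ ∪ B₁`, `X₁` closed and transversal to the snc divisor `B₁`, total transforms non-zero) every framed point has a
  frame in which the total transform of `f` reads as a unit times a monomial.
-/

noncomputable section

open CategoryTheory AlgebraicGeometry TopologicalSpace IsLocalRing
open Literature.AlgebraicGeometry.Resolution
open Scheme.IdealSheafData

set_option linter.dupNamespace false -- mandated namespace of this single-conjunct summit

namespace Summit.ResolutionOfSingularities.ResolutionOfSingularities.Theorems.TrackC

variable {k : Type} [Field k]

/-! ## Transport off the centre -/

/-- **Frames transport off the centre.** For a blow-up `τ : Z'' ⟶ Z'` along `C` and a point `x'` with `τ x' ∉ V(C)`, a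
Cohen frame `F` at `τ x'` for `σ` gives a Cohen frame `F''` at `x'` for `τ ≫ σ` with the same reading of every total transform.
[OURS · folklore] -/
theorem exists_frame_transport {Z' Z'' : Scheme.{0}} (σ : Z' ⟶ Spec (.of (MvPowerSeries (Fin 3) k)))
    (C : Z'.IdealSheafData) (τ : Z'' ⟶ Z') (hτ : IsBlowup τ C) (x' : Z'') (hz : τ x' ∉ C.support)
    (hN : IsNoetherianRing (Z'.presheaf.stalk (τ x'))) (F : @Frame k _ Z' σ (τ x') hN) :
    ∃ (hN'' : IsNoetherianRing (Z''.presheaf.stalk x')) (F'' : @Frame k _ Z'' (τ ≫ σ) x' hN''),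
      ∀ f : MvPowerSeries (Fin 3) k,
        F''.e (algebraMap _ _ (totalGerm (τ ≫ σ) x' f)) = F.e (algebraMap _ _ (totalGerm σ (τ x') f)) := by
  haveI := hτ.isIso_stalkMap_of_not_mem_support (x' := x') hz
  haveI := hN
  let ε : Z'.presheaf.stalk (τ x') ≃+* Z''.presheaf.stalk x' := (asIso (τ.stalkMap x')).commRingCatIsoToRingEquiv
  have hε : ∀ a, ε a = (τ.stalkMap x').hom a := fun a => rfl
  haveI hN'' : IsNoetherianRing (Z''.presheaf.stalk x') := isNoetherianRing_of_ringEquiv _ ε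
  have hmax : (maximalIdeal (Z'.presheaf.stalk (τ x'))).map ε.toRingHom = maximalIdeal (Z''.presheaf.stalk x') :=
    map_ringEquiv_maximalIdeal ε
  let εh := adicCompletionCongr _ _ ε hmax
  have hgerm : ∀ s : Γ(Z', ⊤), (Z''.presheaf.germ ⊤ x' trivial).hom (τ.appTop.hom s) =
      ε ((Z'.presheaf.germ ⊤ (τ x') trivial).hom s) := fun s => by
    rw [hε]
    exact (Scheme.Hom.germ_stalkMap_apply τ ⊤ x' trivial s).symm
  let F'' : @Frame k _ Z'' (τ ≫ σ) x' hN'' :=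
    { e := εh.symm.trans F.e
      map_const := fun a => by
        have h1 : stalkConst (τ ≫ σ) x' a = ε (stalkConst σ (τ x') a) := by
          change (Z''.presheaf.germ ⊤ x' trivial).hom ((τ ≫ σ).appTop.hom _) = _
          rw [Scheme.Hom.comp_appTop, CommRingCat.comp_apply, hgerm]
          rfl
        change F.e (εh.symm (AdicCompletion.of _ _ (stalkConst (τ ≫ σ) x' a))) = _
        rw [h1, ← adicCompletionCongr_of _ _ ε hmax, RingEquiv.symm_apply_apply]
        exact F.map_const a }
  refine ⟨hN'', F'', fun f => ?_⟩
  have h2 : totalGerm (τ ≫ σ) x' f = ε (totalGerm σ (τ x') f) := by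
    change (Z''.presheaf.germ ⊤ x' trivial).hom ((τ ≫ σ).appTop.hom _) = _
    rw [Scheme.Hom.comp_appTop, CommRingCat.comp_apply, hgerm]
    rfl
  change F.e (εh.symm (AdicCompletion.of _ _ (totalGerm (τ ≫ σ) x' f))) = _
  rw [h2, ← adicCompletionCongr_of _ _ ε hmax, RingEquiv.symm_apply_apply]
  rfl

/-! ## The tautological frame at the closed point of `Z₀` -/

/-- **The tautological frame.** The closed point of `Z₀ = Spec k⟦x₀,x₁,x₂⟧` carries a Cohen frame for `𝟙 Z₀` in which the total
transform of every `f` reads as `f`. [OURS · folklore] -/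
theorem exists_tautological_frame (k : Type) [Field k] :
    ∃ (hN : IsNoetherianRing ((Spec (.of (MvPowerSeries (Fin 3) k))).presheaf.stalk (closedPoint (MvPowerSeries (Fin 3) k))))
      (F : @Frame k _ (Spec (.of (MvPowerSeries (Fin 3) k))) (𝟙 _) (closedPoint (MvPowerSeries (Fin 3) k)) hN),
      ∀ f : MvPowerSeries (Fin 3) k,
        F.e (algebraMap _ _ (totalGerm (𝟙 (Spec (.of (MvPowerSeries (Fin 3) k)))) (closedPoint _) f)) = f := by
  let z₀ : Spec (.of (MvPowerSeries (Fin 3) k)) := closedPoint (MvPowerSeries (Fin 3) k)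
  let O : Type := (Spec (.of (MvPowerSeries (Fin 3) k))).presheaf.stalk z₀
  letI : Algebra (MvPowerSeries (Fin 3) k) O := StructureSheaf.stalkAlgebra (MvPowerSeries (Fin 3) k) z₀
  haveI : IsLocalization.AtPrime O (maximalIdeal (MvPowerSeries (Fin 3) k)) :=
    StructureSheaf.IsLocalization.to_stalk (MvPowerSeries (Fin 3) k) z₀
  haveI hRN : IsNoetherianRing (MvPowerSeries (Fin 3) k) := isNoetherianRing_mvPowerSeries (Fin 3) (R := k)
  have H : (maximalIdeal (MvPowerSeries (Fin 3) k)).primeCompl ≤ IsUnit.submonoid (MvPowerSeries (Fin 3) k) :=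
    fun x hx => by
      change IsUnit x
      by_contra hux
      exact hx ((IsLocalRing.mem_maximalIdeal x).mpr (mem_nonunits_iff.mpr hux))
  let ι : MvPowerSeries (Fin 3) k ≃ₐ[MvPowerSeries (Fin 3) k] O :=
    IsLocalization.atUnits (MvPowerSeries (Fin 3) k) (maximalIdeal (MvPowerSeries (Fin 3) k)).primeCompl H
  have hι : ∀ r : MvPowerSeries (Fin 3) k, ι r = algebraMap (MvPowerSeries (Fin 3) k) O r := fun r => by
    simpa using ι.commutes r
  haveI hN : IsNoetherianRing O := isNoetherianRing_of_ringEquiv (MvPowerSeries (Fin 3) k) ι.toRingEquiv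
  haveI : IsAdicComplete (maximalIdeal (MvPowerSeries (Fin 3) k)) (MvPowerSeries (Fin 3) k) := by
    rw [maximalIdeal_mvPowerSeries_eq_span]
    infer_instance
  haveI : IsAdicComplete (maximalIdeal O) O := by
    have h1 := (IsAdicComplete.congr_ringEquiv (maximalIdeal (MvPowerSeries (Fin 3) k)) ι.toRingEquiv).mpr ‹_›
    rwa [map_ringEquiv_maximalIdeal] at h1
  let e : AdicCompletion (maximalIdeal O) O ≃+* MvPowerSeries (Fin 3) k :=
    (AdicCompletion.ofAlgEquiv (maximalIdeal O)).symm.toRingEquiv.trans ι.symm.toRingEquiv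
  have he : ∀ r : MvPowerSeries (Fin 3) k, e (algebraMap O _ (algebraMap (MvPowerSeries (Fin 3) k) O r)) = r :=
    fun r => by
      change ι.symm ((AdicCompletion.ofAlgEquiv (maximalIdeal O)).symm
        (AdicCompletion.of (maximalIdeal O) O (algebraMap (MvPowerSeries (Fin 3) k) O r))) = r
      rw [AdicCompletion.ofAlgEquiv_symm_of, ← hι, AlgEquiv.symm_apply_apply]
  have hgerm : ∀ r : MvPowerSeries (Fin 3) k, (Spec (.of (MvPowerSeries (Fin 3) k))).presheaf.germ ⊤ z₀ trivial
      ((Scheme.ΓSpecIso (.of (MvPowerSeries (Fin 3) k))).inv.hom r) =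
        algebraMap (MvPowerSeries (Fin 3) k) O r := fun r => rfl
  have hid : ∀ r : MvPowerSeries (Fin 3) k,
      (𝟙 (Spec (.of (MvPowerSeries (Fin 3) k))) : Spec (.of (MvPowerSeries (Fin 3) k)) ⟶ _).appTop.hom
        ((Scheme.ΓSpecIso (.of (MvPowerSeries (Fin 3) k))).inv.hom r) =
        (Scheme.ΓSpecIso (.of (MvPowerSeries (Fin 3) k))).inv.hom r := fun r => by
    rw [Scheme.Hom.id_appTop]; rfl
  let F : @Frame k _ (Spec (.of (MvPowerSeries (Fin 3) k))) (𝟙 _) z₀ hN :=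
    { e := e
      map_const := fun a => by
        change e (algebraMap O _ ((Spec (.of (MvPowerSeries (Fin 3) k))).presheaf.germ ⊤ z₀ trivial
          ((𝟙 (Spec (.of (MvPowerSeries (Fin 3) k))) : Spec (.of (MvPowerSeries (Fin 3) k)) ⟶ _).appTop.hom
            ((Scheme.ΓSpecIso (.of (MvPowerSeries (Fin 3) k))).inv.hom (MvPowerSeries.C a))))) = _
        rw [hid, hgerm, he] }
  refine ⟨hN, F, fun f => ?_⟩
  change e (algebraMap O _ ((Spec (.of (MvPowerSeries (Fin 3) k))).presheaf.germ ⊤ z₀ trivial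
    ((𝟙 (Spec (.of (MvPowerSeries (Fin 3) k))) : Spec (.of (MvPowerSeries (Fin 3) k)) ⟶ _).appTop.hom
      ((Scheme.ΓSpecIso (.of (MvPowerSeries (Fin 3) k))).inv.hom f)))) = f
  rw [hid, hgerm, he]

/-! ## Monomial frames at the end of the sequence -/

section Core

variable {Z : Scheme.{0}} {σ : Z ⟶ Spec (.of (MvPowerSeries (Fin 3) k))} {z : Z}
  [hN : IsNoetherianRing (Z.presheaf.stalk z)]

/-- **Monomial frame from prime factors.** At a framed point, if every prime factor of a non-zero element `t` of the local
ring is associated to a member of a regular system of parameters `y`, then in the frame ADAPTED to `y` the element `t` reads as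
a unit times a monomial. [OURS · folklore] -/
theorem exists_monomial_frame_of_prime_dvd_rsop (F : Frame σ z) {d : ℕ} (y : Fin d → Z.presheaf.stalk z)
    (hspan : Ideal.span (Set.range y) = maximalIdeal (Z.presheaf.stalk z))
    (hdim : ringKrullDim (Z.presheaf.stalk z) = d) (t : Z.presheaf.stalk z) (ht : t ≠ 0)
    (hprime : ∀ q : Z.presheaf.stalk z, Prime q → q ∣ t → ∃ i, Associated q (y i)) :
    ∃ (F' : Frame σ z) (u : MvPowerSeries (Fin 3) k) (a : Fin 3 → ℕ), MvPowerSeries.constantCoeff u ≠ 0 ∧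
      F'.e (algebraMap _ _ t) = u * ∏ i, MvPowerSeries.X i ^ a i := by
  haveI := F.isRegularLocalRing
  have hd : d = 3 := by
    have h := hdim.symm.trans F.ringKrullDim_eq
    exact_mod_cast h
  subst hd
  have hy : IsRsopPart y :=
    ⟨F.isRegularLocalRing, 0, Fin.elim0, by simpa using hdim, by simpa using hspan⟩
  obtain ⟨u, a, hu, hta⟩ := exists_eq_unit_mul_prod_pow_of_prime_dvd hy ht hprime
  obtain ⟨F', hF'⟩ := F.exists_adapted y hspan
  have hT : F'.e (algebraMap _ _ t) = F'.e (algebraMap _ _ u) * ∏ i, MvPowerSeries.X i ^ a i := by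
    rw [hta, map_mul, map_mul, map_prod, map_prod]
    simp only [map_pow, hF']
  have hu' : MvPowerSeries.constantCoeff (F'.e (algebraMap _ _ u)) ≠ 0 := by
    have h1 : IsUnit (F'.e (algebraMap _ _ u)) := (hu.map _).map _
    rw [MvPowerSeries.isUnit_iff_constantCoeff] at h1
    exact h1.ne_zero
  exact ⟨F', _, a, hu', hT⟩

end Core

section End

variable (f : MvPowerSeries (Fin 3) k) {Z₁ : Scheme.{0}} (π : Z₁ ⟶ Spec (.of (MvPowerSeries (Fin 3) k)))
  (X₁ B₁ : Set Z₁)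

/-- **MONOMIAL FRAMES AT THE END.** At the end `π : Z₁ ⟶ Z₀` of the Cossart–Jannsen–Saito sequence of `V(f) ⊆ Z₀` —
`π⁻¹(V f) = X₁ ∪ B₁`, `X₁` closed and transversal to the strict normal crossings divisor `B₁`, total transforms non-zero — every
framed point `z` has a frame in which the total transform of `f` reads as a unit times a monomial (the case analysis of
`wonAt_end`, game-independent). [OURS · folklore] -/
theorem exists_monomial_frame_end (hX₁c : IsClosed X₁) (hB₁ : IsStrictNormalCrossingsDivisor Z₁ B₁)
    (htot : π ⁻¹' ((Spec (.of (MvPowerSeries (Fin 3) k))).zeroLocus (U := ⊤)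
      {(Scheme.ΓSpecIso (.of (MvPowerSeries (Fin 3) k))).inv.hom f} : Set _) = X₁ ∪ B₁)
    (htr : IsTransversalWith Z₁ X₁ B₁) (hT : ∀ z : Z₁, totalGerm π z f ≠ 0)
    (z : Z₁) (hN : IsNoetherianRing (Z₁.presheaf.stalk z)) (F : @Frame k _ Z₁ π z hN) :
    ∃ (F' : @Frame k _ Z₁ π z hN) (u : MvPowerSeries (Fin 3) k) (a : Fin 3 → ℕ), MvPowerSeries.constantCoeff u ≠ 0 ∧
      F'.e (algebraMap _ _ (totalGerm π z f)) = u * ∏ i, MvPowerSeries.X i ^ a i := by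
  haveI := hN
  haveI := F.isRegularLocalRing
  haveI := isDomain_of_isRegularLocalRing (Z₁.presheaf.stalk z)
  have hrad := radical_span_totalGerm π f z
  have hcl : (⟨π ⁻¹' ((Spec (.of (MvPowerSeries (Fin 3) k))).zeroLocus (U := ⊤)
      {(Scheme.ΓSpecIso (.of (MvPowerSeries (Fin 3) k))).inv.hom f}),
      (isClosed_zeroLocus f).preimage π.continuous⟩ : Closeds Z₁) = ⟨X₁, hX₁c⟩ ⊔ ⟨B₁, hB₁.1⟩ :=
    Closeds.ext (by simpa using htot)
  rw [hcl, vanishingIdeal_sup, stalkIdeal_inf] at hrad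
  have hclX : (⟨closure X₁, isClosed_closure⟩ : Closeds Z₁) = ⟨X₁, hX₁c⟩ := Closeds.ext hX₁c.closure_eq
  have hclB : (⟨closure B₁, isClosed_closure⟩ : Closeds Z₁) = ⟨B₁, hB₁.1⟩ := Closeds.ext hB₁.1.closure_eq
  have hq : ∀ q : Z₁.presheaf.stalk z, Prime q → q ∣ totalGerm π z f →
      stalkIdeal (vanishingIdeal ⟨X₁, hX₁c⟩) z ≤ Ideal.span {q} ∨
        stalkIdeal (vanishingIdeal ⟨B₁, hB₁.1⟩) z ≤ Ideal.span {q} := by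
    intro q hq hdvd
    have hP : (Ideal.span {q}).IsPrime := (Ideal.span_singleton_prime hq.ne_zero).mpr hq
    have h1 : (Ideal.span {totalGerm π z f}).radical ≤ Ideal.span {q} :=
      hP.radical_le_iff.mpr (Ideal.span_singleton_le_span_singleton.mpr hdvd)
    rw [hrad] at h1
    exact hP.inf_le.mp h1
  by_cases hzX : z ∈ X₁
  · obtain ⟨-, r, e, zv, w, J, hdim, hspan, hIX, hIB⟩ := htr z hzX
    rw [hclX] at hIX
    rw [hclB] at hIB
    refine exists_monomial_frame_of_prime_dvd_rsop F (Fin.append zv w) (by rwa [range_fin_append]) hdim _ (hT z) ?_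
    intro q hq' hdvd
    rcases hq q hq' hdvd with h | h
    · rcases Nat.eq_zero_or_pos r with hr | hr
      · exfalso
        subst hr
        have h0 : Ideal.span (Set.range zv) = ⊥ := by
          rw [Set.range_eq_empty zv, Ideal.span_empty]
        rw [hIX, h0, bot_inf_eq] at hrad
        have : totalGerm π z f ∈ (Ideal.span {totalGerm π z f}).radical :=
          Ideal.le_radical (Ideal.mem_span_singleton_self _)
        rw [hrad] at this
        exact hT z ((Submodule.mem_bot _).mp this)
      · rw [hIX, Ideal.span_le] at h
        have hmem : zv ⟨0, hr⟩ ∈ Ideal.span {q} := h ⟨⟨0, hr⟩, rfl⟩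
        refine ⟨Fin.castAdd e ⟨0, hr⟩, ?_⟩
        rw [Fin.append_left]
        have hyz : IsRsopPart (Fin.append zv w) :=
          ⟨F.isRegularLocalRing, 0, Fin.elim0, by simpa using hdim, by simpa [range_fin_append] using hspan⟩
        have hp : Prime (zv ⟨0, hr⟩) := by
          have := hyz.prime (Fin.castAdd e ⟨0, hr⟩)
          rwa [Fin.append_left] at this
        exact hq'.irreducible.associated_of_dvd hp.irreducible (Ideal.mem_span_singleton.mp hmem)
    · rw [hIB, Ideal.span_singleton_le_span_singleton] at h
      obtain ⟨j, -, hj⟩ := (hq'.dvd_finsetProd_iff _).mp h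
      refine ⟨Fin.natAdd r j, ?_⟩
      rw [Fin.append_right]
      have hyz : IsRsopPart (Fin.append zv w) :=
        ⟨F.isRegularLocalRing, 0, Fin.elim0, by simpa using hdim, by simpa [range_fin_append] using hspan⟩
      have hp : Prime (w j) := by
        have := hyz.prime (Fin.natAdd r j)
        rwa [Fin.append_right] at this
      exact hq'.irreducible.associated_of_dvd hp.irreducible hj
  · have hIXtop : stalkIdeal (vanishingIdeal ⟨X₁, hX₁c⟩) z = ⊤ := by
      apply stalkIdeal_eq_top_of_not_mem_support
      rw [← SetLike.mem_coe, coe_support_vanishingIdeal]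
      exact hzX
    by_cases hzB : z ∈ B₁
    · obtain ⟨-, r, e, x, y, -, hdim, hspan, hI⟩ := (hB₁.isStrictNormalCrossingsAt hzB)
      rw [hclB] at hI
      refine exists_monomial_frame_of_prime_dvd_rsop F (Fin.append x y) (by rwa [range_fin_append]) hdim _ (hT z) ?_
      intro q hq' hdvd
      rcases hq q hq' hdvd with h | h
      · exfalso
        rw [hIXtop, top_le_iff, Ideal.span_singleton_eq_top] at h
        exact hq'.not_unit h
      · rw [hI, Ideal.span_singleton_le_span_singleton] at h
        obtain ⟨i, -, hi⟩ := (hq'.dvd_finsetProd_iff _).mp h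
        refine ⟨Fin.castAdd e i, ?_⟩
        rw [Fin.append_left]
        have hyz : IsRsopPart (Fin.append x y) :=
          ⟨F.isRegularLocalRing, 0, Fin.elim0, by simpa using hdim, by simpa [range_fin_append] using hspan⟩
        have hp : Prime (x i) := by
          have := hyz.prime (Fin.castAdd e i)
          rwa [Fin.append_left] at this
        exact hq'.irreducible.associated_of_dvd hp.irreducible hi
    · have hIBtop : stalkIdeal (vanishingIdeal ⟨B₁, hB₁.1⟩) z = ⊤ := by
        apply stalkIdeal_eq_top_of_not_mem_support
        rw [← SetLike.mem_coe, coe_support_vanishingIdeal]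
        exact hzB
      rw [hIXtop, hIBtop, top_inf_eq, Ideal.radical_eq_top, Ideal.span_singleton_eq_top] at hrad
      have hunit : IsUnit (F.e (algebraMap _ _ (totalGerm π z f))) := (hrad.map _).map _
      refine ⟨F, F.e (algebraMap _ _ (totalGerm π z f)), fun _ => 0, ?_, by simp⟩
      exact (MvPowerSeries.isUnit_iff_constantCoeff.mp hunit).ne_zero

end End

end Summit.ResolutionOfSingularities.ResolutionOfSingularities.Theorems.TrackC

end
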